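import Summits.CriticalPhenomena.PercolationContinuityZ3.Theorems.PercNearOneGluingNoHeavyLowerTailThreePartitionJuntaBlockKleitman
import HarnessLib.Audit

/-!
# `NoHeavyLowerTail` (crux stmt-CriticalPhenomena-4575), master-family hierarchy P3 (gen 38): patterns of a block with ONE MORE COORDINATE —
# bookkeeping for the closure of the signature method under conjunction with a new coin (file `…ThreePartitionJuntaAndVar`)

Support file (seat `prim-masterthm-p3`; `--supports stmt-CriticalPhenomena-4575`; memo
`run/shared/lean/prim/prim-masterthm/FROM-prim-masterthm-p3-g38-PDC-STRUCTURE.md` §3).  Let `κ` be a pure diagonal certificate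
(`DiagCert τ Q 𝔘 κ`, file `…ThreePartitionJuntaCert`) for an up-set `𝔘` of Q-parts, and let `x ∉ Q`.  Put `𝔘 ∧ x := andVar x 𝔘 = {m : x ∈ m, m \ {x} ∈ 𝔘}`
(so `liftQ (insert x Q) (𝔘 ∧ x) = liftQ Q 𝔘 ∩ {S : x ∈ S}`) and `κ'(m) = [x ∈ m]·w·κ(m \ {x})` with `w = 2` if `x ∈ τ` and `w = 1` otherwise.
THIS FILE (bookkeeping only): the patterns of `insert x Q` are the patterns `P` of `Q` with `x` placed in one of the three parts
(`sum_cfgsIn_insert`), the subsets of `insert x Q` are those of `Q` with or without `x` (`sum_subsetsOf_insert`); the twisted parts of the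
extended patterns pick up `x` in the part holding `x` (untwisted `x`) or in the two other parts (twisted `x`) (`qc_ins₁/₂/₃`); the conjunction
`andVar x 𝔘` and the `x`-section `secVar x 𝔄 = {m : insert x m ∈ 𝔄}` of a signature, with `liftQ (insert x Q) (andVar x 𝔘) = liftQ Q 𝔘 ∩ {S : x ∈ S}`.
The theorem `DiagCert.andVar` (`κ'` is a certificate) is in `…ThreePartitionJuntaAndVar`.  HONEST LABEL: identities; nothing here bears on the
(closed) crux; the general conjecture stays OPEN. [this work]
-/

noncomputable section

open Finset
open scoped symmDiff Classical

namespace Summit.CriticalPhenomena.PercolationContinuityZ3.Theorems.ThreePartition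

variable {ι : Type*} [Fintype ι]

/-! ## Set algebra for one new coordinate -/

section SetAlgebra

variable {x : ι} {A B : Set ι}

omit [Fintype ι] in
/-- `insert x A ∆ B = insert x (A ∆ B)` when `x ∉ A, B`. [folklore] -/
theorem symmDiff_insert_left_eq (hA : x ∉ A) (hB : x ∉ B) : insert x A ∆ B = insert x (A ∆ B) := by
  ext c; simp only [Set.mem_symmDiff, Set.mem_insert_iff]
  by_cases hc : c = x
  · subst hc; tauto
  · tauto

omit [Fintype ι] in
/-- `A ∆ insert x B = insert x (A ∆ B)` when `x ∉ A, B`. [folklore] -/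
theorem symmDiff_insert_right_eq (hA : x ∉ A) (hB : x ∉ B) : A ∆ insert x B = insert x (A ∆ B) := by
  rw [symmDiff_comm, symmDiff_insert_left_eq hB hA, symmDiff_comm]

omit [Fintype ι] in
/-- `insert x A ∆ insert x B = A ∆ B` when `x ∉ A, B`. [folklore] -/
theorem symmDiff_insert_insert_eq (hA : x ∉ A) (hB : x ∉ B) : insert x A ∆ insert x B = A ∆ B := by
  ext c; simp only [Set.mem_symmDiff, Set.mem_insert_iff]
  by_cases hc : c = x
  · subst hc; tauto
  · tauto

end SetAlgebra

/-! ## Patterns of `insert x Q`: the three placements of `x` -/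

section Insert

variable {x : ι} {Q : Set ι}

/-- The patterns of `insert x Q` are obtained from the patterns of `Q` by placing `x` in part 1, part 2 or part 3. [this work] -/
theorem sum_cfgsIn_insert (hx : x ∉ Q) (f : Set ι × Set ι → ℤ) :
    ∑ P ∈ cfgsIn (insert x Q), f P = ∑ P ∈ cfgsIn Q, (f (insert x P.1, P.2) + f (P.1, insert x P.2) + f P) := by
  rw [sum_add_distrib, sum_add_distrib]
  -- split the big pattern set by the position of `x`
  have hsplit : cfgsIn (insert x Q) =
      ((cfgsIn Q).image fun P => (insert x P.1, P.2)) ∪ ((cfgsIn Q).image fun P => (P.1, insert x P.2)) ∪ cfgsIn Q := by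
    ext P
    simp only [mem_union, mem_image, mem_cfgsIn]
    constructor
    · rintro ⟨h1, h2, hd⟩
      by_cases hx1 : x ∈ P.1
      · refine Or.inl (Or.inl ⟨(P.1 \ {x}, P.2), ⟨fun c hc => ?_, fun c hc => ?_, ?_⟩, ?_⟩)
        · exact (Set.mem_insert_iff.1 (h1 hc.1)).resolve_left hc.2
        · exact (Set.mem_insert_iff.1 (h2 hc)).resolve_left fun h => Set.disjoint_left.1 hd hx1 (h ▸ hc)
        · exact Disjoint.mono_left Set.sdiff_subset hd
        · simp only [Set.insert_sdiff_singleton, Set.insert_eq_of_mem hx1]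
      · by_cases hx2 : x ∈ P.2
        · refine Or.inl (Or.inr ⟨(P.1, P.2 \ {x}), ⟨fun c hc => ?_, fun c hc => ?_, ?_⟩, ?_⟩)
          · exact (Set.mem_insert_iff.1 (h1 hc)).resolve_left fun h => hx1 (h ▸ hc)
          · exact (Set.mem_insert_iff.1 (h2 hc.1)).resolve_left hc.2
          · exact Disjoint.mono_right Set.sdiff_subset hd
          · simp only [Set.insert_sdiff_singleton, Set.insert_eq_of_mem hx2]
        · refine Or.inr ⟨fun c hc => ?_, fun c hc => ?_, hd⟩
          · exact (Set.mem_insert_iff.1 (h1 hc)).resolve_left fun h => hx1 (h ▸ hc)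
          · exact (Set.mem_insert_iff.1 (h2 hc)).resolve_left fun h => hx2 (h ▸ hc)
    · rintro ((⟨P', ⟨h1, h2, hd⟩, rfl⟩ | ⟨P', ⟨h1, h2, hd⟩, rfl⟩) | ⟨h1, h2, hd⟩)
      · refine ⟨Set.insert_subset_iff.2 ⟨Set.mem_insert _ _, h1.trans (Set.subset_insert _ _)⟩, h2.trans (Set.subset_insert _ _), ?_⟩
        exact Set.disjoint_left.2 fun c hc hc2 => by
          rcases Set.mem_insert_iff.1 hc with h | h
          · exact hx (h ▸ h2 hc2)
          · exact Set.disjoint_left.1 hd h hc2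
      · refine ⟨h1.trans (Set.subset_insert _ _), Set.insert_subset_iff.2 ⟨Set.mem_insert _ _, h2.trans (Set.subset_insert _ _)⟩, ?_⟩
        exact Set.disjoint_right.2 fun c hc hc1 => by
          rcases Set.mem_insert_iff.1 hc with h | h
          · exact hx (h ▸ h1 hc1)
          · exact Set.disjoint_right.1 hd h hc1
      · exact ⟨h1.trans (Set.subset_insert _ _), h2.trans (Set.subset_insert _ _), hd⟩
  -- pairwise disjointness and injectivity
  have hx1 : ∀ P ∈ cfgsIn Q, x ∉ P.1 := fun P hP h => hx ((mem_cfgsIn.1 hP).1 h)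
  have hx2 : ∀ P ∈ cfgsIn Q, x ∉ P.2 := fun P hP h => hx ((mem_cfgsIn.1 hP).2.1 h)
  have inj1 : ∀ P ∈ cfgsIn Q, ∀ P' ∈ cfgsIn Q, (insert x P.1, P.2) = (insert x P'.1, P'.2) → P = P' := by
    intro P hP P' hP' h
    have h1 : insert x P.1 = insert x P'.1 := (Prod.mk.inj h).1
    have e1 : P.1 = P'.1 := by
      rw [← Set.insert_sdiff_self_of_notMem (hx1 P hP), h1, Set.insert_sdiff_self_of_notMem (hx1 P' hP')]
    exact Prod.ext e1 (Prod.mk.inj h).2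
  have inj2 : ∀ P ∈ cfgsIn Q, ∀ P' ∈ cfgsIn Q, (P.1, insert x P.2) = (P'.1, insert x P'.2) → P = P' := by
    intro P hP P' hP' h
    have h2 : insert x P.2 = insert x P'.2 := (Prod.mk.inj h).2
    have e2 : P.2 = P'.2 := by
      rw [← Set.insert_sdiff_self_of_notMem (hx2 P hP), h2, Set.insert_sdiff_self_of_notMem (hx2 P' hP')]
    exact Prod.ext (Prod.mk.inj h).1 e2
  have d12 : Disjoint ((cfgsIn Q).image fun P => (insert x P.1, P.2)) ((cfgsIn Q).image fun P => (P.1, insert x P.2)) := by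
    rw [disjoint_left]; intro P h h'
    rw [mem_image] at h h'
    obtain ⟨P₁, hP₁, rfl⟩ := h
    obtain ⟨P₂, hP₂, e⟩ := h'
    have : x ∈ P₂.1 := by rw [(Prod.mk.inj e).1]; exact Set.mem_insert _ _
    exact hx1 P₂ hP₂ this
  have d3 : Disjoint (((cfgsIn Q).image fun P => (insert x P.1, P.2)) ∪ ((cfgsIn Q).image fun P => (P.1, insert x P.2))) (cfgsIn Q) := by
    rw [disjoint_left]; intro P h h'
    rcases mem_union.1 h with h | h
    · obtain ⟨P₁, _, rfl⟩ := mem_image.1 h; exact hx1 _ h' (Set.mem_insert _ _)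
    · obtain ⟨P₁, _, rfl⟩ := mem_image.1 h; exact hx2 _ h' (Set.mem_insert _ _)
  rw [hsplit, sum_union d3, sum_union d12, sum_image inj1, sum_image inj2]

/-- The subsets of `insert x Q` are the subsets of `Q` with or without `x`. [this work] -/
theorem sum_subsetsOf_insert (hx : x ∉ Q) (g : Set ι → ℤ) :
    ∑ m ∈ subsetsOf (insert x Q), g m = ∑ m ∈ subsetsOf Q, (g (insert x m) + g m) := by
  rw [sum_add_distrib]
  have hxm : ∀ m ∈ subsetsOf Q, x ∉ m := fun m hm h => hx (mem_subsetsOf.1 hm h)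
  have hsplit : subsetsOf (insert x Q) = ((subsetsOf Q).image fun m => insert x m) ∪ subsetsOf Q := by
    ext m
    simp only [mem_union, mem_image, mem_subsetsOf]
    constructor
    · intro hm
      by_cases hxm' : x ∈ m
      · refine Or.inl ⟨m \ {x}, fun c hc => (Set.mem_insert_iff.1 (hm hc.1)).resolve_left hc.2, ?_⟩
        simp only [Set.insert_sdiff_singleton, Set.insert_eq_of_mem hxm']
      · exact Or.inr fun c hc => (Set.mem_insert_iff.1 (hm hc)).resolve_left fun h => hxm' (h ▸ hc)
    · rintro (⟨m', hm', rfl⟩ | hm)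
      · exact Set.insert_subset_insert hm'
      · exact hm.trans (Set.subset_insert _ _)
  have inj : ∀ m ∈ subsetsOf Q, ∀ m' ∈ subsetsOf Q, insert x m = insert x m' → m = m' := fun m hm m' hm' h => by
    rw [← Set.insert_sdiff_self_of_notMem (hxm m hm), h, Set.insert_sdiff_self_of_notMem (hxm m' hm')]
  have d : Disjoint ((subsetsOf Q).image fun m => insert x m) (subsetsOf Q) := by
    rw [disjoint_left]; intro m h h'
    obtain ⟨m₁, _, rfl⟩ := mem_image.1 h
    exact hxm _ h' (Set.mem_insert _ _)
  rw [hsplit, sum_union d, sum_image inj]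

variable (τ : Set ι)

omit [Fintype ι] in
/-- Third part when `x` goes to part 1. [this work] -/
theorem pt₃_ins₁ (hx : x ∉ Q) (P : Set ι × Set ι) : pt₃ (insert x Q) (insert x P.1, P.2) = pt₃ Q P := by
  unfold pt₃; ext c; simp only [Set.mem_sdiff, Set.mem_insert_iff, Set.mem_union]
  constructor
  · rintro ⟨h | h, hn⟩
    · exact absurd (Or.inl (Or.inl h)) hn
    · exact ⟨h, fun h' => hn (h'.elim (fun h1 => Or.inl (Or.inr h1)) Or.inr)⟩
  · rintro ⟨hQ, hn⟩
    exact ⟨Or.inr hQ, fun h' => h'.elim (fun h1 => h1.elim (fun e => hx (e ▸ hQ)) fun h1 => hn (Or.inl h1)) fun h2 => hn (Or.inr h2)⟩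

omit [Fintype ι] in
/-- Third part when `x` goes to part 2. [this work] -/
theorem pt₃_ins₂ (hx : x ∉ Q) (P : Set ι × Set ι) : pt₃ (insert x Q) (P.1, insert x P.2) = pt₃ Q P := by
  unfold pt₃; ext c; simp only [Set.mem_sdiff, Set.mem_insert_iff, Set.mem_union]
  constructor
  · rintro ⟨h | h, hn⟩
    · exact absurd (Or.inr (Or.inl h)) hn
    · exact ⟨h, fun h' => hn (h'.elim Or.inl fun h2 => Or.inr (Or.inr h2))⟩
  · rintro ⟨hQ, hn⟩
    exact ⟨Or.inr hQ, fun h' => h'.elim (fun h1 => hn (Or.inl h1)) fun h2 => h2.elim (fun e => hx (e ▸ hQ)) fun h2 => hn (Or.inr h2)⟩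

/-- Third part when `x` goes to part 3. [this work] -/
theorem pt₃_ins₃ (hx : x ∉ Q) {P : Set ι × Set ι} (hP : P ∈ cfgsIn Q) : pt₃ (insert x Q) P = insert x (pt₃ Q P) := by
  rw [mem_cfgsIn] at hP
  unfold pt₃; ext c; simp only [Set.mem_sdiff, Set.mem_insert_iff, Set.mem_union]
  constructor
  · rintro ⟨h | h, hn⟩
    · exact Or.inl h
    · exact Or.inr ⟨h, hn⟩
  · rintro (h | ⟨hQ, hn⟩)
    · subst h; exact ⟨Or.inl rfl, fun h' => h'.elim (fun h1 => hx (hP.1 h1)) fun h2 => hx (hP.2.1 h2)⟩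
    · exact ⟨Or.inr hQ, hn⟩

variable {τ}

omit [Fintype ι] in
/-- The twist seen by the bigger block. [this work] -/
theorem twist_inter_insert_eq (Q : Set ι) (x : ι) : τ ∩ insert x Q = if x ∈ τ then insert x (τ ∩ Q) else τ ∩ Q := by
  split_ifs with h
  · exact Set.inter_insert_of_mem h
  · exact Set.inter_insert_of_notMem h


/-! ### The twisted parts of the extended patterns -/

variable (τ)

/-- Twisted parts when `x` goes to part 1: `x` joins copy 1 if `x ∉ τ`, copies 2 and 3 if `x ∈ τ`. [this work] -/
theorem qc_ins₁ (hx : x ∉ Q) {P : Set ι × Set ι} (hP : P ∈ cfgsIn Q) :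
    qc₁ τ (insert x Q) (insert x P.1, P.2) = (if x ∈ τ then qc₁ τ Q P else insert x (qc₁ τ Q P)) ∧
    qc₂ τ (insert x Q) (insert x P.1, P.2) = (if x ∈ τ then insert x (qc₂ τ Q P) else qc₂ τ Q P) ∧
    qc₃ τ (insert x Q) (insert x P.1, P.2) = (if x ∈ τ then insert x (qc₃ τ Q P) else qc₃ τ Q P) := by
  have hP' := mem_cfgsIn.1 hP
  have h1 : x ∉ P.1 := fun h => hx (hP'.1 h)
  have h2 : x ∉ P.2 := fun h => hx (hP'.2.1 h)
  have h3 : x ∉ pt₃ Q P := fun h => hx h.1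
  have hτ : x ∉ τ ∩ Q := fun h => hx h.2
  unfold qc₁ qc₂ qc₃
  rw [pt₃_ins₁ hx, twist_inter_insert_eq]
  split_ifs with hxτ
  · exact ⟨symmDiff_insert_insert_eq h1 hτ, symmDiff_insert_right_eq h2 hτ, symmDiff_insert_right_eq h3 hτ⟩
  · exact ⟨symmDiff_insert_left_eq h1 hτ, rfl, rfl⟩

/-- Twisted parts when `x` goes to part 2. [this work] -/
theorem qc_ins₂ (hx : x ∉ Q) {P : Set ι × Set ι} (hP : P ∈ cfgsIn Q) :
    qc₁ τ (insert x Q) (P.1, insert x P.2) = (if x ∈ τ then insert x (qc₁ τ Q P) else qc₁ τ Q P) ∧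
    qc₂ τ (insert x Q) (P.1, insert x P.2) = (if x ∈ τ then qc₂ τ Q P else insert x (qc₂ τ Q P)) ∧
    qc₃ τ (insert x Q) (P.1, insert x P.2) = (if x ∈ τ then insert x (qc₃ τ Q P) else qc₃ τ Q P) := by
  have hP' := mem_cfgsIn.1 hP
  have h1 : x ∉ P.1 := fun h => hx (hP'.1 h)
  have h2 : x ∉ P.2 := fun h => hx (hP'.2.1 h)
  have h3 : x ∉ pt₃ Q P := fun h => hx h.1
  have hτ : x ∉ τ ∩ Q := fun h => hx h.2
  unfold qc₁ qc₂ qc₃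
  rw [pt₃_ins₂ hx, twist_inter_insert_eq]
  split_ifs with hxτ
  · exact ⟨symmDiff_insert_right_eq h1 hτ, symmDiff_insert_insert_eq h2 hτ, symmDiff_insert_right_eq h3 hτ⟩
  · exact ⟨rfl, symmDiff_insert_left_eq h2 hτ, rfl⟩

/-- Twisted parts when `x` goes to part 3. [this work] -/
theorem qc_ins₃ (hx : x ∉ Q) {P : Set ι × Set ι} (hP : P ∈ cfgsIn Q) :
    qc₁ τ (insert x Q) P = (if x ∈ τ then insert x (qc₁ τ Q P) else qc₁ τ Q P) ∧
    qc₂ τ (insert x Q) P = (if x ∈ τ then insert x (qc₂ τ Q P) else qc₂ τ Q P) ∧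
    qc₃ τ (insert x Q) P = (if x ∈ τ then qc₃ τ Q P else insert x (qc₃ τ Q P)) := by
  have hP' := mem_cfgsIn.1 hP
  have h1 : x ∉ P.1 := fun h => hx (hP'.1 h)
  have h2 : x ∉ P.2 := fun h => hx (hP'.2.1 h)
  have h3 : x ∉ pt₃ Q P := fun h => hx h.1
  have hτ : x ∉ τ ∩ Q := fun h => hx h.2
  unfold qc₁ qc₂ qc₃
  rw [pt₃_ins₃ hx hP, twist_inter_insert_eq]
  split_ifs with hxτ
  · exact ⟨symmDiff_insert_right_eq h1 hτ, symmDiff_insert_right_eq h2 hτ, symmDiff_insert_insert_eq h3 hτ⟩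
  · exact ⟨rfl, rfl, symmDiff_insert_left_eq h3 hτ⟩

end Insert

/-! ## Conjunction with a new coin, and sections of signatures -/

section AndVar

variable (x : ι)

omit [Fintype ι] in
/-- `𝔘 ∧ x`: the Q∪{x}-parts containing `x` whose Q-part lies in `𝔘`. [this work] -/
def andVar (𝔘 : Set (Set ι)) : Set (Set ι) := {m | x ∈ m ∧ m \ {x} ∈ 𝔘}

omit [Fintype ι] in
/-- The `x`-section of a signature: `{m : insert x m ∈ 𝔄}`. [this work] -/
def secVar (𝔄 : Set (Set ι)) : Set (Set ι) := {m | insert x m ∈ 𝔄}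

variable {x}

omit [Fintype ι] in
/-- Membership in `secVar`. [this work] -/
@[simp] theorem mem_secVar {𝔄 : Set (Set ι)} {m : Set ι} : m ∈ secVar x 𝔄 ↔ insert x m ∈ 𝔄 := Iff.rfl

omit [Fintype ι] in
/-- `insert x m ∈ 𝔘 ∧ x ↔ m ∈ 𝔘` for `x ∉ m`. [this work] -/
theorem insert_mem_andVar_iff {𝔘 : Set (Set ι)} {m : Set ι} (hm : x ∉ m) : insert x m ∈ andVar x 𝔘 ↔ m ∈ 𝔘 := by
  show (x ∈ insert x m ∧ insert x m \ {x} ∈ 𝔘) ↔ m ∈ 𝔘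
  rw [Set.insert_sdiff_self_of_notMem hm]
  exact ⟨fun h => h.2, fun h => ⟨Set.mem_insert _ _, h⟩⟩

omit [Fintype ι] in
/-- A part avoiding `x` is never in `𝔘 ∧ x`. [this work] -/
theorem not_mem_andVar {𝔘 : Set (Set ι)} {m : Set ι} (hm : x ∉ m) : m ∉ andVar x 𝔘 := fun h => hm h.1

omit [Fintype ι] in
/-- `𝔘 ∧ x` is an up-set if `𝔘` is. [this work] -/
theorem isUpperSet_andVar {𝔘 : Set (Set ι)} (h𝔘 : IsUpperSet 𝔘) : IsUpperSet (andVar x 𝔘) :=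
  fun _ _ hab ha => ⟨hab ha.1, h𝔘 (Set.sdiff_subset_sdiff_left hab) ha.2⟩

omit [Fintype ι] in
/-- The section of an up-set is an up-set. [this work] -/
theorem isUpperSet_secVar {𝔄 : Set (Set ι)} (h𝔄 : IsUpperSet 𝔄) : IsUpperSet (secVar x 𝔄) :=
  fun _ _ hab ha => h𝔄 (Set.insert_subset_insert hab) ha

omit [Fintype ι] in
/-- An up-set lies below its section. [this work] -/
theorem mem_secVar_of_mem {𝔄 : Set (Set ι)} (h𝔄 : IsUpperSet 𝔄) {m : Set ι} (hm : m ∈ 𝔄) : m ∈ secVar x 𝔄 :=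
  h𝔄 (Set.subset_insert _ _) hm

omit [Fintype ι] in
/-- **The junta of `𝔘 ∧ x` on `insert x Q` is the junta of `𝔘` on `Q` cut by the coin `x`** (`x ∉ Q`). [this work] -/
theorem liftQ_insert_andVar {Q : Set ι} (hx : x ∉ Q) (𝔘 : Set (Set ι)) :
    liftQ (insert x Q) (andVar x 𝔘) = liftQ Q 𝔘 ∩ {S | x ∈ S} := by
  ext S
  simp only [mem_liftQ, Set.mem_inter_iff, Set.mem_setOf_eq]
  show (x ∈ S ∩ insert x Q ∧ (S ∩ insert x Q) \ {x} ∈ 𝔘) ↔ _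
  have e : (S ∩ insert x Q) \ {x} = S ∩ Q := by
    ext c; simp only [Set.mem_sdiff, Set.mem_inter_iff, Set.mem_insert_iff, Set.mem_singleton_iff]
    constructor
    · rintro ⟨⟨hS, h | h⟩, hne⟩
      · exact absurd h hne
      · exact ⟨hS, h⟩
    · rintro ⟨hS, hQ⟩; exact ⟨⟨hS, Or.inr hQ⟩, fun h => hx (h ▸ hQ)⟩
  rw [e]
  exact ⟨fun h => ⟨h.2, h.1.1⟩, fun h => ⟨⟨h.2, Set.mem_insert _ _⟩, h.1⟩⟩

end AndVar

end Summit.CriticalPhenomena.PercolationContinuityZ3.Theorems.ThreePartition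

end
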